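import Summits.RiemannHypothesis.RiemannHypothesis.Theorems.MotivicDoorFunctionFieldInstances

/-!
# The function-field door (FF-DOOR, statement (ii)) — part 5: the twin FAMILY `x² - t x + t²` is ONE
# window tower
(pub-rhdoor, seat ff-2, gen 3; HONEST FRAMING: lottery ticket at the motivic door; RH probability
negligible; consolation prizes are real: a new semi-local Weil-positivity theorem, or a located gap in the
Connes–Consani programme, plus the ff-door theorem.  Nothing in this file is a statement about `ζ`.)

`PfPersistence.FfAngleTwin` (pub-rhpf) proved on hand-entered root multisets that the data
`(4, x² - 2x + 4)` and `(49, x² - 7x + 49)` have the same window tower (`windowForm_4_49`), noting that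
"the identification with `Polynomial.roots` is not needed for the door".  Here we supply that
identification and the whole one-parameter family at once, def-free:

* `traceSq_map_eq` — over `ℂ`, `x² - t x + t² = (x - tζ)(x - tζ̄)` with `ζ = (1 + i√3)/2`.  [PROVED]
* `frobRoots_traceSq` — `frobRoots (x² - t x + t²) = {tζ, tζ̄}` (genuine `Polynomial.roots`);
  `frobRoots_traceSq_two = rootsQ4`, `frobRoots_traceSq_seven = rootsQ49` (bridges to pub-rhpf's
  hand-entered multisets).  [PROVED]
* `normRoots_frobRoots_traceSq` — for `t ≥ 1` the normalised roots at `q = t²` are `{ζ, ζ̄}`, independent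
  of `t`.  [PROVED]
* `weilWindowTower_traceSq_eq` — hence for all `t, s ≥ 1`:
  `weilWindowTower (t²) (x² - t x + t²) = weilWindowTower (s²) (x² - s x + s²)`: the entire family is ONE
  tower (every window functional, local or not, scale-free or not, is CONSTANT on the family).  [PROVED]
  Against this constant, part 3 (`twin49_of_period_two`, `twin4_of_period_one`) shows the door value —
  geometric at exponent `1` or only at even exponents — varies with the Honda–Tate period, which for
  `t = p^k` is `2` or `1` according as `p ≡ 1 (mod 3)` or not (DATA, by the cited Honda–Tate formula;
  not formalised; FF-DOOR (ii).O.2).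
-/

set_option linter.dupNamespace false  -- the mandated namespace repeats `RiemannHypothesis`

open Polynomial Complex

namespace Summit.RiemannHypothesis.RiemannHypothesis.Theorems.MotivicDoor.FunctionField

open Summit.RiemannHypothesis.RiemannHypothesis.Theorems.PfPersistence.FfAngleTwin

/-- `(√3)² = 3` in `ℂ`. [PROVED] -/
private theorem sqrt3_sq : ((Real.sqrt 3 : ℂ)) ^ 2 = 3 := by
  rw [← Complex.ofReal_pow, Real.sq_sqrt (by norm_num : (0:ℝ) ≤ 3)]; norm_num

/-- `ζ ζ̄ = 1` for `ζ = (1 + i√3)/2`. [PROVED] -/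
private theorem zeta_mul_zetaBar :
    ((1 + (Real.sqrt 3 : ℂ) * I) / 2) * ((1 - (Real.sqrt 3 : ℂ) * I) / 2) = 1 := by
  linear_combination (-(1:ℂ) / 4 * I ^ 2) * sqrt3_sq + (-(3:ℂ) / 4) * Complex.I_sq

/-- `(x - a)(x - b) = x² - (a + b) x + ab`. [PROVED] -/
private theorem X_sub_C_mul_X_sub_C (a b : ℂ) :
    (X - Polynomial.C a) * (X - Polynomial.C b) =
      X ^ 2 - Polynomial.C (a + b) * X + Polynomial.C (a * b) := by
  simp only [map_add, map_mul]
  ring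

/-- **`x² - t x + t² = (x - tζ)(x - tζ̄)` over `ℂ`**, `ζ = (1 + i√3)/2`. [PROVED] -/
theorem traceSq_map_eq (t : ℕ) :
    (X ^ 2 - C (t : ℤ) * X + C ((t : ℤ) ^ 2) : ℤ[X]).map (Int.castRingHom ℂ) =
      (X - Polynomial.C ((t : ℂ) * ((1 + (Real.sqrt 3 : ℂ) * I) / 2))) *
        (X - Polynomial.C ((t : ℂ) * ((1 - (Real.sqrt 3 : ℂ) * I) / 2))) := by
  have hsum : (t : ℂ) * ((1 + (Real.sqrt 3 : ℂ) * I) / 2) + (t : ℂ) * ((1 - (Real.sqrt 3 : ℂ) * I) / 2)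
      = t := by ring
  have hprod : (t : ℂ) * ((1 + (Real.sqrt 3 : ℂ) * I) / 2) * ((t : ℂ) * ((1 - (Real.sqrt 3 : ℂ) * I) / 2))
      = (t : ℂ) ^ 2 := by
    calc (t : ℂ) * ((1 + (Real.sqrt 3 : ℂ) * I) / 2) * ((t : ℂ) * ((1 - (Real.sqrt 3 : ℂ) * I) / 2))
        = (t : ℂ) ^ 2 * (((1 + (Real.sqrt 3 : ℂ) * I) / 2) * ((1 - (Real.sqrt 3 : ℂ) * I) / 2)) := by
          ring
      _ = (t : ℂ) ^ 2 := by rw [zeta_mul_zetaBar, mul_one]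
  rw [X_sub_C_mul_X_sub_C, hsum, hprod]
  simp only [Polynomial.map_add, Polynomial.map_sub, Polynomial.map_mul, Polynomial.map_pow,
    Polynomial.map_X, map_natCast, map_pow, Polynomial.map_natCast]

/-- **The complex roots of `x² - t x + t²` are `tζ, tζ̄`** (as a multiset, `Polynomial.roots`). [PROVED] -/
theorem frobRoots_traceSq (t : ℕ) :
    frobRoots (X ^ 2 - C (t : ℤ) * X + C ((t : ℤ) ^ 2)) =
      {(t : ℂ) * ((1 + (Real.sqrt 3 : ℂ) * I) / 2), (t : ℂ) * ((1 - (Real.sqrt 3 : ℂ) * I) / 2)} := by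
  unfold frobRoots
  rw [traceSq_map_eq, Polynomial.roots_mul (mul_ne_zero (X_sub_C_ne_zero _) (X_sub_C_ne_zero _)),
    Polynomial.roots_X_sub_C, Polynomial.roots_X_sub_C]
  rfl

/-- Bridge to pub-rhpf: `frobRoots (x² - 2x + 4) = rootsQ4 = {1 ± i√3}`. [PROVED] -/
theorem frobRoots_traceSq_two :
    frobRoots (X ^ 2 - C ((2 : ℕ) : ℤ) * X + C (((2 : ℕ) : ℤ) ^ 2)) = rootsQ4 := by
  rw [frobRoots_traceSq]
  simp only [rootsQ4, Multiset.insert_eq_cons]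
  push_cast
  congr 1
  · ring
  · congr 1; ring

/-- Bridge to pub-rhpf: `frobRoots (x² - 7x + 49) = rootsQ49 = {(7 ± 7i√3)/2}`. [PROVED] -/
theorem frobRoots_traceSq_seven :
    frobRoots (X ^ 2 - C ((7 : ℕ) : ℤ) * X + C (((7 : ℕ) : ℤ) ^ 2)) = rootsQ49 := by
  rw [frobRoots_traceSq]
  simp only [rootsQ49, Multiset.insert_eq_cons]
  push_cast
  congr 1
  · ring
  · congr 1; ring

/-- **The normalised roots at `q = t²` are `{ζ, ζ̄}`, independent of `t ≥ 1`.** [PROVED] -/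
theorem normRoots_frobRoots_traceSq {t : ℕ} (ht : 0 < t) :
    normRoots ((t : ℝ) ^ 2) (frobRoots (X ^ 2 - C (t : ℤ) * X + C ((t : ℤ) ^ 2))) =
      {(1 + (Real.sqrt 3 : ℂ) * I) / 2, (1 - (Real.sqrt 3 : ℂ) * I) / 2} := by
  rw [frobRoots_traceSq]
  have hsq : ((Real.sqrt ((t : ℝ) ^ 2) : ℝ) : ℂ) = (t : ℂ) := by
    rw [Real.sqrt_sq (Nat.cast_nonneg _), Complex.ofReal_natCast]
  have ht' : (t : ℂ) ≠ 0 := by exact_mod_cast ht.ne'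
  simp only [normRoots, Multiset.insert_eq_cons, Multiset.map_cons, Multiset.map_singleton, hsq]
  congr 1
  · rw [mul_comm, mul_div_assoc, div_self ht', mul_one]
  · congr 1
    rw [mul_comm, mul_div_assoc, div_self ht', mul_one]

/-- **The twin FAMILY is one tower.**  For all `t, s ≥ 1` the window towers of the honest data
`(t², x² - t x + t²)` and `(s², x² - s x + s²)` coincide — every window functional is constant on the
family, while geometric origin at exponent `1` is not (part 3; FF-DOOR (ii).O.2). [PROVED] -/
theorem weilWindowTower_traceSq_eq {t s : ℕ} (ht : 0 < t) (hs : 0 < s) :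
    weilWindowTower ((t : ℝ) ^ 2) (X ^ 2 - C (t : ℤ) * X + C ((t : ℤ) ^ 2)) =
      weilWindowTower ((s : ℝ) ^ 2) (X ^ 2 - C (s : ℤ) * X + C ((s : ℤ) ^ 2)) := by
  show ffWindowTower _ (frobRoots _) = ffWindowTower _ (frobRoots _)
  exact ffWindowTower_eq_of_twin
    (by rw [normRoots_frobRoots_traceSq ht, normRoots_frobRoots_traceSq hs])

/-- The same with `q` presented as a natural number `t²` (the form `(Nat.card K : ℝ)` takes when
`#K = t²`). [PROVED] -/
theorem weilWindowTower_traceSq_eq_natCast {t s : ℕ} (ht : 0 < t) (hs : 0 < s) :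
    weilWindowTower ((t ^ 2 : ℕ) : ℝ) (X ^ 2 - C (t : ℤ) * X + C ((t : ℤ) ^ 2)) =
      weilWindowTower ((s ^ 2 : ℕ) : ℝ) (X ^ 2 - C (s : ℤ) * X + C ((s : ℤ) ^ 2)) := by
  push_cast
  exact weilWindowTower_traceSq_eq ht hs

/-- In particular pub-rhpf's `windowForm_4_49` for the genuine root multisets: the towers of
`(4, x² - 2x + 4)` and `(49, x² - 7x + 49)` coincide. [PROVED] -/
theorem weilWindowTower_4_49 :
    weilWindowTower 4 (X ^ 2 - C ((2 : ℕ) : ℤ) * X + C (((2 : ℕ) : ℤ) ^ 2)) =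
      weilWindowTower 49 (X ^ 2 - C ((7 : ℕ) : ℤ) * X + C (((7 : ℕ) : ℤ) ^ 2)) := by
  have h := weilWindowTower_traceSq_eq (t := 2) (s := 7) (by norm_num) (by norm_num)
  norm_num at h
  exact h

end Summit.RiemannHypothesis.RiemannHypothesis.Theorems.MotivicDoor.FunctionField
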